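import Literature.Barriers.CriticalPhenomena.KozmaNachmiasLemma53
import Literature.Probability.Percolation.TreeGraphBoundGeneral
import HarnessLib

/-!
# Kozma–Nachmias 2011, Lemma 5.5 — first half: the BK–Reimer step and the regularity volume bound

Barrier catalogue `Literature/Barriers/CriticalPhenomena/` (D-0021), programme for the named fact
`KozmaNachmias2011_thm2` via `KozmaNachmias2011_lemma51` (`KozmaNachmiasTheorem2.lean`). Lemma 5.5
of Kozma–Nachmias 2011 (p. 401) bounds `Σ_y P(E₁ ∩ E₂ ∩ ¬E₃)`, where `E₂ = {x' ↔ y off C(x;Q_j)}`,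
`E₃ = {C(x) ∩ C(x') = ∅}` (`KozmaNachmiasLemma53.lean`). This file PROVES the two probabilistic
inputs of the printed proof (pp. 401–403):

* **the BK–Reimer inclusion** `eventE1_inter_eventE2_inter_compl_eventE3_subset` (p. 402, (5.8)):
  on `E₁ ∩ E₂ ∩ ¬E₃` there is a vertex `z` with `(E₁ ∩ {0 ↔ z}) ∘ {x' ↔ z} ∘ {z ↔ y}` — "let `γ` be
  an open path between `x'` and `y` which avoids `C(x; Q_j)` … there must exist an open path `η`
  connecting a vertex of `C(0;Q_j)` to a vertex `z` on `γ` such that `η ∩ (C(0;Q_j) ∪ γ) = ∅`; to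
  verify `E₁ ∩ {0 ↔ z}` it suffices to observe the edges of `C(x;Q_j)` and `η`" — and its
  consequence with Reimer's inequality (`reimer_local_finitary_list`, `ReimerLocalFinitary.lean`):
  `P(⋃_{z ∈ Λ_N} ⋯) ≤ Σ_{z ∈ Λ_N} P(E₁ ∩ {0 ↔ z}) τ(x',z) τ(z,y)` (`real_biUnion_bkr_le_sum`), with
  the truncations `Λ_N ↑ ℤ^d` (`tendsto_real_biUnion_bkr`);
* **the regularity volume bound** `sum_real_eventE1_inter_openConn_le` (pp. 402–403, (5.11)–(5.12)):
  for `s ≥ K`, `Σ_{u ∈ Q_s} P(E₁ ∩ {x ↔ x+u}) ≤ ψ(s) P(E₁)` with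
  `ψ(s) = s⁴ log⁷ s + (2s+1)^d e^{-log² s}` (`KozmaNachmiasTails.psiKN`): on the typical event
  `T_s(x)` the count is `< s⁴ log⁷ s`, and `P(E₁ ∩ ¬T_s(x)) ≤ e^{-log² s} P(E₁)` since `x` is
  `K`-regular on `E₁` (`real_eventE1_inter_compl_typical_le`, `KozmaNachmiasE1.lean`).

## References

* G. Kozma, A. Nachmias, *Arm exponents in high dimensional percolation*, J. Amer. Math. Soc. 24
  (2011) 375–409: Lemma 5.5 and its proof ((5.8)–(5.12), pp. 401–403).
* G. Grimmett, *Percolation*, 2nd ed., Springer 1999, §2.3 (BK and Reimer inequalities).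
-/

noncomputable section

namespace Literature.Barriers.CriticalPhenomena

open _root_.MeasureTheory _root_.Filter _root_.Topology Finset Literature.Probability.LatticeModels
  Literature.Probability.Percolation Literature.Probability.Percolation.DCT16
open scoped Literature.Probability.LatticeModels Literature.Probability.Percolation

variable {d : ℕ}

/-! ### A counting inequality -/

section Counting

/-- **Counting inequality**: if on `H` at most `B` of the events `G_a`, `a ∈ I`, occur, then
`Σ_{a ∈ I} P(G_a ∩ H) ≤ B · P(H)` (both sides are expectations of the count restricted to `H`).
[cite: KozmaNachmias2011, proof of Lemma 5.5 ((5.11), p. 403: the bound C 2^{4t} t⁷ on the typical event)] -/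
theorem sum_measureReal_inter_le_of_count_le {Ω ι : Type*} [MeasurableSpace Ω] (μ : Measure Ω)
    [IsFiniteMeasure μ] (I : Finset ι) (G : ι → Set Ω) [∀ ω, DecidablePred fun a => ω ∈ G a]
    (hG : ∀ a ∈ I, MeasurableSet (G a))
    {H : Set Ω} (hH : MeasurableSet H) {B : ℝ}
    (hcount : ∀ ω ∈ H, (#(I.filter fun a => ω ∈ G a) : ℝ) ≤ B) :
    ∑ a ∈ I, μ.real (G a ∩ H) ≤ B * μ.real H := by
  have hlhs : ∀ a ∈ I, μ.real (G a ∩ H) = ∫ ω, (G a ∩ H).indicator (1 : Ω → ℝ) ω ∂μ :=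
    fun a ha => (integral_indicator_one ((hG a ha).inter hH)).symm
  have hint : ∀ a ∈ I, Integrable (fun ω => (G a ∩ H).indicator (1 : Ω → ℝ) ω) μ :=
    fun a ha => (integrable_const (1 : ℝ)).indicator ((hG a ha).inter hH)
  have hpt : ∀ ω, ∑ a ∈ I, (G a ∩ H).indicator (1 : Ω → ℝ) ω ≤ H.indicator (fun _ => B) ω := by
    intro ω
    by_cases hω : ω ∈ H
    · rw [Set.indicator_of_mem hω]
      have : ∑ a ∈ I, (G a ∩ H).indicator (1 : Ω → ℝ) ω = #(I.filter fun a => ω ∈ G a) := by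
        rw [Finset.card_filter, Nat.cast_sum]
        refine Finset.sum_congr rfl fun a _ => ?_
        by_cases ha : ω ∈ G a
        · rw [Set.indicator_of_mem (show ω ∈ G a ∩ H from ⟨ha, hω⟩), if_pos ha]; simp
        · rw [Set.indicator_of_notMem (fun h => ha h.1), if_neg ha]; simp
      rw [this]
      exact hcount ω hω
    · rw [Set.indicator_of_notMem hω]
      exact le_of_eq (Finset.sum_eq_zero fun a _ => Set.indicator_of_notMem (fun h => hω h.2) _)
  calc ∑ a ∈ I, μ.real (G a ∩ H)
      = ∑ a ∈ I, ∫ ω, (G a ∩ H).indicator (1 : Ω → ℝ) ω ∂μ := Finset.sum_congr rfl hlhs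
    _ = ∫ ω, ∑ a ∈ I, (G a ∩ H).indicator (1 : Ω → ℝ) ω ∂μ := (integral_finsetSum I hint).symm
    _ ≤ ∫ ω, H.indicator (fun _ => B) ω ∂μ := by
        refine integral_mono (integrable_finsetSum I hint) ((integrable_const B).indicator hH) hpt
    _ = B * μ.real H := by rw [integral_indicator_const _ hH, smul_eq_mul, mul_comm]

end Counting

/-! ### The regularity volume bound (5.11)–(5.12) -/

section Regularity

variable (p : unitInterval) (j K M : ℕ) (x : Site d)

/-- On `E₁(x)`, `0 ↔ x`, so `E₁ ∩ {0 ↔ z} = E₁ ∩ {x ↔ z}`. [cite: KozmaNachmias2011, proof of Lemma 5.5 (p. 402)] -/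
theorem eventE1_inter_openConn_zero_eq (z : Site d) :
    eventE1 p j K M x ∩ openConn (0 : Site d) z = eventE1 p j K M x ∩ openConn x z := by
  ext ω
  simp only [Set.mem_inter_iff, and_congr_right_iff]
  intro hω
  have h0x : (openGraph ω).Reachable 0 x := reachable_of_pathIn (pathIn_of_mem_openConnIn (mem_eventE1.1 hω).1)
  exact ⟨fun h => h0x.symm.trans h, fun h => h0x.trans h⟩

/-- **(5.11)–(5.12)**: for `s ≥ K`, `Σ_{u ∈ Q_s} P(E₁(x) ∩ {x ↔ x+u}) ≤ ψ(s) P(E₁(x))` — on the typical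
event `T_s(x)` at most `s⁴ log⁷ s` of the events occur, and `P(E₁ ∩ ¬T_s(x)) ≤ e^{-log² s} P(E₁)`,
each of the `(2s+1)^d` remaining terms being at most that.
[cite: KozmaNachmias2011, proof of Lemma 5.5 ((5.11)–(5.12), pp. 402–403)] -/
theorem sum_real_eventE1_inter_openConn_le {s : ℕ} (hs : K ≤ s) :
    ∑ u ∈ box d s, (bondPercolation (zdGraph d) p).real (eventE1 p j K M x ∩ openConn x (x + u)) ≤
      psiKN d s * (bondPercolation (zdGraph d) p).real (eventE1 p j K M x) := by
  classical
  set μ := bondPercolation (zdGraph d) p with hμ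
  have hE1m : MeasurableSet (eventE1 (d := d) p j K M x) := measurableSet_eventE1 p j K M x
  have hTm : MeasurableSet (typicalEvent d s x) := measurableSet_typicalEvent d s x
  -- split according to the typical event
  have hsplit : ∀ u ∈ box d s, μ.real (eventE1 p j K M x ∩ openConn x (x + u)) =
      μ.real (openConn x (x + u) ∩ (eventE1 p j K M x ∩ typicalEvent d s x)) +
        μ.real (openConn x (x + u) ∩ (eventE1 p j K M x ∩ (typicalEvent d s x)ᶜ)) := by
    intro u _
    have h := measureReal_inter_add_sdiff (μ := μ) (s := eventE1 p j K M x ∩ openConn x (x + u)) hTm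
    rw [← h]
    congr 1
    · congr 1; ext ω; simp only [Set.mem_inter_iff]; tauto
    · congr 1; ext ω; simp only [Set.mem_inter_iff, Set.mem_sdiff, Set.mem_compl_iff]; tauto
  rw [Finset.sum_congr rfl hsplit, Finset.sum_add_distrib]
  -- typical part: the count is `< s⁴ log⁷ s`
  have h1 : ∑ u ∈ box d s, μ.real (openConn x (x + u) ∩ (eventE1 p j K M x ∩ typicalEvent d s x)) ≤
      (s : ℝ) ^ 4 * Real.log s ^ 7 * μ.real (eventE1 p j K M x ∩ typicalEvent d s x) := by
    refine sum_measureReal_inter_le_of_count_le μ (box d s) (fun u => (openConn x (x + u) : Set (BondConfig (Site d))))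
      (fun u _ => measurableSet_openConn_holds x (x + u)) (hE1m.inter hTm) ?_
    rintro ω ⟨-, hT⟩
    rw [typicalEvent, Set.mem_setOf_eq] at hT
    unfold localClusterCard at hT
    exact hT.le
  -- atypical part
  have h2 : ∑ u ∈ box d s, μ.real (openConn x (x + u) ∩ (eventE1 p j K M x ∩ (typicalEvent d s x)ᶜ)) ≤
      (2 * (s : ℝ) + 1) ^ d * (Real.exp (-(Real.log s ^ 2)) * μ.real (eventE1 p j K M x)) := by
    calc ∑ u ∈ box d s, μ.real (openConn x (x + u) ∩ (eventE1 p j K M x ∩ (typicalEvent d s x)ᶜ))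
        ≤ ∑ _u ∈ box d s, Real.exp (-(Real.log s ^ 2)) * μ.real (eventE1 p j K M x) :=
          Finset.sum_le_sum fun u _ => (measureReal_mono Set.inter_subset_right (measure_ne_top _ _)).trans
            (real_eventE1_inter_compl_typical_le p j K M x hs)
      _ = #(box d s) * (Real.exp (-(Real.log s ^ 2)) * μ.real (eventE1 p j K M x)) := by
          rw [Finset.sum_const, nsmul_eq_mul]
      _ = (2 * (s : ℝ) + 1) ^ d * (Real.exp (-(Real.log s ^ 2)) * μ.real (eventE1 p j K M x)) := by
          rw [card_box]; push_cast; ring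
  have h3 : μ.real (eventE1 p j K M x ∩ typicalEvent d s x) ≤ μ.real (eventE1 p j K M x) :=
    measureReal_mono Set.inter_subset_left (measure_ne_top _ _)
  have hlog : 0 ≤ (s : ℝ) ^ 4 * Real.log s ^ 7 := by
    have : 0 ≤ Real.log s := Real.log_natCast_nonneg s
    positivity
  calc _ ≤ (s : ℝ) ^ 4 * Real.log s ^ 7 * μ.real (eventE1 p j K M x ∩ typicalEvent d s x) +
        (2 * (s : ℝ) + 1) ^ d * (Real.exp (-(Real.log s ^ 2)) * μ.real (eventE1 p j K M x)) := add_le_add h1 h2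
    _ ≤ (s : ℝ) ^ 4 * Real.log s ^ 7 * μ.real (eventE1 p j K M x) +
        (2 * (s : ℝ) + 1) ^ d * (Real.exp (-(Real.log s ^ 2)) * μ.real (eventE1 p j K M x)) := by
        linarith [mul_le_mul_of_nonneg_left h3 hlog]
    _ = psiKN d s * μ.real (eventE1 p j K M x) := by rw [psiKN]; ring

end Regularity

/-! ### First hits along walks -/

section Walks

variable {V : Type*} {G : SimpleGraph V}

/-- **First hit of a set along a walk, as a sub-walk**: a walk ending in `T` has an initial segment
ending at a vertex `z ∈ T`, with support contained in that of the walk, all of whose other vertices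
lie outside `T`. [cite: KozmaNachmias2011, proof of Lemma 5.5 (p. 402: the path η and the vertex z on γ)] -/
theorem exists_firstHit_prefix (T : Set V) :
    ∀ {u v : V} (w : G.Walk u v), v ∈ T →
      ∃ z ∈ T, ∃ σ : G.Walk u z, σ.support ⊆ w.support ∧ ∀ a ∈ σ.support, a ∈ T → a = z := by
  intro u v w
  induction w with
  | nil => intro hu; exact ⟨_, hu, SimpleGraph.Walk.nil, by simp, fun a ha _ => by simpa using ha⟩
  | @cons a b c hab w ih =>
    intro hc
    by_cases ha : a ∈ T
    · exact ⟨a, ha, SimpleGraph.Walk.nil, by simp, fun y hy _ => by simpa using hy⟩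
    · obtain ⟨z, hz, σ, hσs, hσ⟩ := ih hc
      refine ⟨z, hz, SimpleGraph.Walk.cons hab σ, ?_, fun y hy hyT => ?_⟩
      · intro y hy
        rw [SimpleGraph.Walk.support_cons, List.mem_cons] at hy ⊢
        rcases hy with rfl | hy
        · exact Or.inl rfl
        · exact Or.inr (hσs hy)
      · rw [SimpleGraph.Walk.support_cons, List.mem_cons] at hy
        rcases hy with rfl | hy
        · exact absurd hyT ha
        · exact hσ y hy hyT

end Walks

/-! ### The BK–Reimer inclusion (5.8) -/

section BKR

variable (p : unitInterval) (j K M : ℕ)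

/-- **(5.8)** (Kozma–Nachmias 2011, p. 402): on `E₁ ∩ E₂ ∩ ¬E₃` there is a vertex `z` such that
`(E₁ ∩ {0 ↔ z}) ∘ {x' ↔ z} ∘ {z ↔ y}` occurs — witnesses: the conditioned pairs of `C(x; Q_j)` together
with an open path `η` from `C(x;Q_j)` to the vertex `z` of the `A`-avoiding open path `γ` from `x'` to
`y` (edge-disjoint from `γ` and from the conditioned pairs), and the two pieces of `γ` at `z`.
[cite: KozmaNachmias2011, proof of Lemma 5.5 ((5.8), p. 402)] -/
theorem eventE1_inter_eventE2_inter_compl_eventE3_subset (x x' y : Site d) :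
    eventE1 p j K M x ∩ eventE2 j x x' y ∩ (eventE3 x x')ᶜ ⊆
      ⋃ z : Site d, (eventE1 p j K M x ∩ openConn (0 : Site d) z) □
        disjointOccurrenceList [openConn x' z, openConn z y] := by
  classical
  rintro ω ⟨⟨hE1, hE2⟩, hE3⟩
  rw [Set.mem_compl_iff, mem_eventE3, not_not] at hE3
  set A := clusterIn (box d j) x ω with hA
  have hx0 := (mem_eventE1.1 hE1).1
  have h0A : (0 : Site d) ∈ A := mem_openConnIn_zero_iff_mem_clusterIn.1 hx0
  have hxbox : x ∈ box d j := Finset.mem_coe.1 (pathIn_of_mem_openConnIn hx0).right_mem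
  have hxA : x ∈ A := self_mem_clusterIn hxbox ω
  -- `γ`: an open path from `x'` to `y` avoiding `A`
  rw [mem_eventE2] at hE2
  obtain ⟨γ₀, hγ₀A'⟩ := ConnDiagram.exists_walk_of_pathIn (pathIn_of_mem_openConnIn hE2)
  have hγ₀A : ∀ v ∈ γ₀.support, v ∉ A := fun v hv h => hγ₀A' v hv (Finset.mem_coe.2 h)
  -- members of an edge of a walk lie on the walk
  have hmem_supp : ∀ {u v : Site d} (w : (openGraph ω).Walk u v) {e : Sym2 (Site d)}, e ∈ w.edges →
      ∀ {b : Site d}, b ∈ e → b ∈ w.support := by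
    intro u v w e he b hb
    induction e using Sym2.ind with
    | h b' c' =>
      rcases Sym2.mem_iff.1 hb with rfl | rfl
      · exact w.fst_mem_support_of_mem_edges he
      · exact w.snd_mem_support_of_mem_edges he
  set γ := γ₀.bypass with hγ
  have hγpath : γ.IsPath := γ₀.bypass_isPath
  have hγA : ∀ v ∈ γ.support, v ∉ A := fun v hv =>
    hγ₀A v (SimpleGraph.Walk.support_bypass_subset_support γ₀ hv)
  -- `z`: the first vertex on `γ` of an open walk from `x` (to `x'`); `η`: its piece after the last visit to `A`
  obtain ⟨ρ⟩ := hE3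
  obtain ⟨z, hzγ, σ₁, -, hσ₁⟩ := exists_firstHit_prefix {v | v ∈ γ.support} ρ (γ.start_mem_support)
  have hz : z ∈ γ.support := hzγ
  obtain ⟨a, haA, η, hηs, hη⟩ := exists_firstHit_prefix (↑A : Set (Site d)) σ₁.reverse (Finset.mem_coe.2 hxA)
  have haA' : a ∈ A := Finset.mem_coe.1 haA
  -- the two pieces of `γ` at `z`
  set γ₁ := γ.takeUntil z hz with hγ₁
  set γ₂ := γ.dropUntil z hz with hγ₂
  have hedges : γ.edges = γ₁.edges ++ γ₂.edges := by
    rw [← SimpleGraph.Walk.edges_append, SimpleGraph.Walk.take_spec]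
  have hnd : (γ₁.edges ++ γ₂.edges).Nodup := hedges ▸ hγpath.edges_nodup
  have hγ₁sub : ∀ e ∈ γ₁.edges, e ∈ γ.edges := fun e he => by rw [hedges]; exact List.mem_append_left _ he
  have hγ₂sub : ∀ e ∈ γ₂.edges, e ∈ γ.edges := fun e he => by rw [hedges]; exact List.mem_append_right _ he
  -- edges of `γ` avoid the conditioned pairs and the edges of `η`
  have hγcp : ∀ e ∈ γ.edges, e ∉ (↑(clusterPairs (box d j) A) : Set (Sym2 (Site d))) := by
    intro e he hcp
    exact notMem_clusterPairs_of_forall (fun w hw => hγA w (hmem_supp γ he hw))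
      (Finset.mem_coe.1 hcp)
  have hγη : ∀ e ∈ γ.edges, e ∉ η.edges := by
    intro e he heη
    have hdiag : e.IsDiag := by
      refine sym2_isDiag_of_forall_eq (z := z) fun v hv => ?_
      have hvη : v ∈ σ₁.support := by
        have := hηs (hmem_supp η heη hv)
        rwa [SimpleGraph.Walk.support_reverse, List.mem_reverse] at this
      exact hσ₁ v hvη (hmem_supp γ he hv)
    exact SimpleGraph.not_isDiag_of_mem_edgeSet _ (γ.edges_subset_edgeSet he) hdiag
  -- the witness of `E₁ ∩ {0 ↔ z}`
  set K₀ : Set (Sym2 (Site d)) := ↑(clusterPairs (box d j) A) ∪ {e | e ∈ η.edges} with hK₀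
  have hK₀ : localCylinder K₀ ω ⊆ eventE1 p j K M x ∩ openConn (0 : Site d) z := by
    intro ω' hω'
    have hat : ω' ∈ clusterAtom (box d j) x ω :=
      mem_clusterAtom_iff.2 fun e he => hω' e (Or.inl (Finset.mem_coe.2 he))
    refine ⟨clusterAtom_subset_eventE1 ω hE1 hat, ?_⟩
    have hC : clusterIn (box d j) x ω' = A := clusterIn_eq_of_mem_clusterAtom hat
    have h0 : (openGraph ω').Reachable x 0 := mem_openConn_of_mem_clusterIn (hC.symm ▸ h0A)
    have ha : (openGraph ω').Reachable x a := mem_openConn_of_mem_clusterIn (hC.symm ▸ haA')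
    have hza : (openGraph ω').Reachable z a := by
      refine (reachable_openGraph_of_walk η (K := ω') fun e he => ?_)
      exact (hω' e (Or.inr he)).2 (mem_of_mem_walk_edges η he)
    exact (h0.symm.trans ha).trans hza.symm
  have key := mem_inter_disjointOccurrenceList_of_witnesses (E := eventE1 p j K M x ∩ openConn (0 : Site d) z)
    (ω := ω) (K₀ := K₀) hK₀
    [((openConn x' z : Set (BondConfig (Site d))), {e | e ∈ γ₁.edges}),
      ((openConn z y : Set (BondConfig (Site d))), {e | e ∈ γ₂.edges})]
  simp only [List.map_cons, List.map_nil] at key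
  refine Set.mem_iUnion.2 ⟨z, key ?_ ?_ ?_ ?_ ?_⟩
  · intro q hq
    simp only [List.mem_cons, List.not_mem_nil, or_false] at hq
    rcases hq with rfl | rfl <;> exact isUpperSet_openConn _ _
  · intro q hq
    simp only [List.mem_cons, List.not_mem_nil, or_false] at hq
    rcases hq with rfl | rfl
    · exact reachable_openGraph_of_walk γ₁ fun e he => he
    · exact reachable_openGraph_of_walk γ₂ fun e he => he
  · intro q hq
    simp only [List.mem_cons, List.not_mem_nil, or_false] at hq
    rcases hq with rfl | rfl
    · exact fun e he => mem_of_mem_walk_edges γ₁ he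
    · exact fun e he => mem_of_mem_walk_edges γ₂ he
  · refine List.pairwise_pair.2 (Set.disjoint_left.2 fun e he₁ he₂ => ?_)
    exact List.disjoint_of_nodup_append hnd he₁ he₂
  · intro q hq
    simp only [List.mem_cons, List.not_mem_nil, or_false] at hq
    rcases hq with rfl | rfl
    · refine Set.disjoint_left.2 fun e he he' => ?_
      rcases he with he | he
      · exact hγcp e (hγ₁sub e he') he
      · exact hγη e (hγ₁sub e he') he
    · refine Set.disjoint_left.2 fun e he he' => ?_
      rcases he with he | he
      · exact hγcp e (hγ₂sub e he') he
      · exact hγη e (hγ₂sub e he') he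

/-- **Reimer bound for the truncated union** (p. 402: "The BK-Reimer inequality gives that
`P(E₁ ∩ E₂ ∩ ¬E₃) ≤ Σ_z P(E₁ ∩ 0 ↔ z) P(x' ↔ z) P(z ↔ y)`"), with the branch point `z` restricted
to `Λ_N`. [cite: KozmaNachmias2011, proof of Lemma 5.5 ((5.8)–(5.9), p. 402)] -/
theorem real_biUnion_bkr_le_sum (x x' y : Site d) (N : ℕ) :
    (bondPercolation (zdGraph d) p).real (⋃ z ∈ box d N, (eventE1 p j K M x ∩ openConn (0 : Site d) z) □
        disjointOccurrenceList [openConn x' z, openConn z y]) ≤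
      ∑ z ∈ box d N, (bondPercolation (zdGraph d) p).real (eventE1 p j K M x ∩ openConn (0 : Site d) z) *
        (tau d p x' z * tau d p z y) := by
  classical
  refine (measureReal_biUnion_finset_le _ _).trans (Finset.sum_le_sum fun z _ => ?_)
  have h := reimer_local_finitary_list (zdGraph d) p (isLocalEvent_eventE1 p j K M x)
    (isUpperSet_openConn (0 : Site d) z) (isFinitary_openConn 0 z) [openConn x' z, openConn z y]
    (by intro D hD; simp only [List.mem_cons, List.not_mem_nil, or_false] at hD
        rcases hD with rfl | rfl <;> exact isUpperSet_openConn _ _)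
    (by intro D hD; simp only [List.mem_cons, List.not_mem_nil, or_false] at hD
        rcases hD with rfl | rfl <;> exact isFinitary_openConn _ _)
  simp only [List.map_cons, List.map_nil, List.prod_cons, List.prod_nil, mul_one] at h
  calc _ ≤ _ := h
    _ = _ := by rw [tau_def, tau_def]

/-- The truncations increase to the full union, whose probability is therefore the limit.
[cite: KozmaNachmias2011, proof of Lemma 5.5 ((5.9), p. 402: the sum over all z)] -/
theorem tendsto_real_biUnion_bkr (x x' y : Site d) :
    Tendsto (fun N : ℕ => (bondPercolation (zdGraph d) p).real (⋃ z ∈ box d N,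
        (eventE1 p j K M x ∩ openConn (0 : Site d) z) □ disjointOccurrenceList [openConn x' z, openConn z y]))
      atTop (𝓝 ((bondPercolation (zdGraph d) p).real (⋃ z : Site d,
        (eventE1 p j K M x ∩ openConn (0 : Site d) z) □ disjointOccurrenceList [openConn x' z, openConn z y]))) := by
  set S : Site d → Set (BondConfig (Site d)) := fun z =>
    (eventE1 p j K M x ∩ openConn (0 : Site d) z) □ disjointOccurrenceList [openConn x' z, openConn z y] with hS
  have hmono : Monotone fun N : ℕ => ⋃ z ∈ box d N, S z := fun N N' h =>
    Set.biUnion_subset_biUnion_left fun z hz => box_mono d h hz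
  have hU : (⋃ N : ℕ, ⋃ z ∈ box d N, S z) = ⋃ z, S z := by
    ext ω
    simp only [Set.mem_iUnion, exists_prop]
    exact ⟨fun ⟨_, z, _, hz⟩ => ⟨z, hz⟩, fun ⟨z, hz⟩ =>
      ⟨Site.supNorm z, z, mem_box_iff_supNorm_le.2 le_rfl, hz⟩⟩
  have h := tendsto_measure_iUnion_atTop (μ := bondPercolation (zdGraph d) p) hmono
  rw [hU] at h
  exact (ENNReal.tendsto_toReal (measure_ne_top _ _)).comp h

/-- **`P(E₁ ∩ E₂ ∩ ¬E₃) ≤ sup_N Σ_{z ∈ Λ_N} P(E₁ ∩ {0 ↔ z}) τ(x',z) τ(z,y)`** in the form used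
downstream: if all truncated sums are `≤ B`, then `P(E₁ ∩ E₂ ∩ ¬E₃) ≤ B`.
[cite: KozmaNachmias2011, proof of Lemma 5.5 ((5.8)–(5.9), p. 402)] -/
theorem real_eventE1_inter_eventE2_inter_compl_eventE3_le (x x' y : Site d) {B : ℝ}
    (hB : ∀ N : ℕ, ∑ z ∈ box d N, (bondPercolation (zdGraph d) p).real
      (eventE1 p j K M x ∩ openConn (0 : Site d) z) * (tau d p x' z * tau d p z y) ≤ B) :
    (bondPercolation (zdGraph d) p).real (eventE1 p j K M x ∩ eventE2 j x x' y ∩ (eventE3 x x')ᶜ) ≤ B := by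
  have h1 := measureReal_mono (μ := bondPercolation (zdGraph d) p)
    (eventE1_inter_eventE2_inter_compl_eventE3_subset p j K M x x' y) (measure_ne_top _ _)
  refine h1.trans (le_of_tendsto' (tendsto_real_biUnion_bkr p j K M x x' y) fun N => ?_)
  exact (real_biUnion_bkr_le_sum p j K M x x' y N).trans (hB N)

end BKR


end Literature.Barriers.CriticalPhenomena

end
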